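import Mathlib
import HarnessLib
import Summits.AtomisticToContinuum.FouriersLaw.Theses.JunctionLocality
import Summits.AtomisticToContinuum.FouriersLaw.Theorems.JunctionLocalityConductanceLowerBoundRelocCrossLevel
import Summits.AtomisticToContinuum.FouriersLaw.Theorems.JunctionLocalityConductanceLowerBoundRelocDirichlet

/-!
# Cold-bath relocation, II: the relocation increment identity, cutoff removed

Helper file (`--supports` stmt-AtomisticToContinuum-11749) for stub `stub_bulkStep` (R5) of the line
`cold-bath-relocation-walk` of the crux `JunctionLocality.ConductanceLowerBound`; part II of `…RelocCrossLevel`.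
Setting: the pinned chain `P = pinnedChain ω₂ lam β γ` (`ω₂ > 0`, `lam, β ≥ 0`, `γ > 0`), `T > 0`, `ρ = e^{-H/T}`,
`μ_T = Z⁻¹ ρ dx` the Gibbs measure, `χ_n = Kubo.chi` the energy cutoffs, `k_0 = p_0² − T` (`kin L 0 − T`), sites
`1 ≤ m`, `m + 2 ≤ L`; a forward field `g ∈ C² ∩ L²(μ_T)` of `X_H + γ(S_0 + S_m)` (cold bath on site `m`) and a
backward field `h ∈ C² ∩ L²(μ_T)` of `−X_H + γ(S_0 + S_{m+1})` (cold bath on site `m+1`), both with source `k_0`.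

* `reloc_increment_identity_density` — against `ρ dx`:
  `γT(∫ χ_n ∂_{p_m} g ∂_{p_m} h ρ − ∫ χ_n ∂_{p_{m+1}} g ∂_{p_{m+1}} h ρ) → ∫ h k_0 ρ − ∫ g k_0 ρ` (`n → ∞`);
* `reloc_increment_identity` / `helper_relocIncrementIdentity` — the same with every integral against `μ_T`.

Proof: the `n → ∞` limit of part I's `reloc_increment_level`.  The source terms converge (`tendsto_integral_chi_mul`,
`k_0 ∈ L²(μ_T)`), and the three cutoff-gradient terms vanish (`tendsto_integral_partialP_chi_mul`) because
`∂_{p_0} g, ∂_{p_m} g ∈ L²(μ_T)` and `∂_{p_0} h, ∂_{p_{m+1}} h ∈ L²(μ_T)` — finite entropy production at the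
thermostatted sites, `Kubo.memLp_partialP` (it allows any `σ`, here `σ = −1` for the backward field).  Only the
DIFFERENCE of the two bulk bilinear forms is asserted to converge: `∂_{p_{m+1}} g` and `∂_{p_m} h` are gradients at
passive sites.  This is the rigorous "second resolvent identity" of the relocation step `m → m+1`
(`L_{m+1} − L_m = γ(S_{m+1} − S_m)` on `L²(μ_T)`).

References: folklore (Green's identities for `σX_H + cS_B` in `L²(e^{-H/T} dx)`; Eckmann–Pillet–Rey-Bellet 1999 §3).
-/

noncomputable section

open MeasureTheory Filter Topology
open scoped ContDiff
open Literature.MathematicalPhysics.KineticTheory.HeatConduction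
open Summit.AtomisticToContinuum.FouriersLaw.Theorems.SuperadditiveResistance.DeviceLiouville
open Summit.AtomisticToContinuum.FouriersLaw.Theorems.SuperadditiveResistance.Kubo
  (chi tendsto_integral_chi_mul tendsto_integral_partialP_chi_mul memLp_partialP integrable_mul_gibbsDensity_iff
    integrable_mul_mul_gibbsDensity)
open Summit.AtomisticToContinuum.FouriersLaw.Cruxes.SuperadditiveResistance.FloatingProbeBypassLaplacian
  (pinnedChain_memLp_two_kin)

namespace Summit.AtomisticToContinuum.FouriersLaw.Cruxes.ConductanceLowerBound.ColdBathRelocationWalk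

section Limit

variable {ω₂ lam β γ : ℝ}

/-- **The relocation increment identity, cutoff removed (against `ρ dx`).** For `g, h ∈ C² ∩ L²(μ_T)` as in
`reloc_increment_level` (`γ > 0`):
`γT(∫ χ_n ∂_m g ∂_m h ρ − ∫ χ_n ∂_{m+1} g ∂_{m+1} h ρ) → ∫ h k_0 ρ − ∫ g k_0 ρ` as `n → ∞` — the source terms converge
(`k_0 ∈ L²(μ_T)`) and the three cutoff-gradient terms vanish (`∂_{p_0} g, ∂_{p_m} g, ∂_{p_0} h, ∂_{p_{m+1}} h ∈ L²(μ_T)` by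
`Kubo.memLp_partialP`). [folklore] -/
theorem reloc_increment_identity_density (hω : 0 < ω₂) (hl : 0 ≤ lam) (hβ : 0 ≤ β) (hγ : 0 < γ) {L m : ℕ}
    (hm : 1 ≤ m) (hmL : m + 2 ≤ L) {T : ℝ} (hT : 0 < T) {g h : PhaseSpace L → ℝ} (hg : ContDiff ℝ 2 g)
    (hh : ContDiff ℝ 2 h) (hg2 : MemLp g 2 ((pinnedChain ω₂ lam β γ).gibbsMeasure L T))
    (hh2 : MemLp h 2 ((pinnedChain ω₂ lam β γ).gibbsMeasure L T))
    (hpg : ∀ x, liouvilleOp (pinnedChain ω₂ lam β γ) L g x + γ * (thermo L 0 T g x + thermo L m T g x) =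
      -(kin L 0 x - T))
    (hph : ∀ x, -liouvilleOp (pinnedChain ω₂ lam β γ) L h x + γ * (thermo L 0 T h x + thermo L (m + 1) T h x) =
      -(kin L 0 x - T)) :
    Tendsto (fun n : ℕ => γ * T *
        ((∫ x, chi (pinnedChain ω₂ lam β γ) L n x * partialP ⟨m, by omega⟩ g x * partialP ⟨m, by omega⟩ h x *
            (pinnedChain ω₂ lam β γ).gibbsDensity L T x) -
          ∫ x, chi (pinnedChain ω₂ lam β γ) L n x * partialP ⟨m + 1, by omega⟩ g x *
            partialP ⟨m + 1, by omega⟩ h x * (pinnedChain ω₂ lam β γ).gibbsDensity L T x)) atTop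
      (𝓝 ((∫ x, h x * (kin L 0 x - T) * (pinnedChain ω₂ lam β γ).gibbsDensity L T x) -
        ∫ x, g x * (kin L 0 x - T) * (pinnedChain ω₂ lam β γ).gibbsDensity L T x)) := by
  have hL0 : 0 < L := by omega
  have hm1L : m + 1 < L := by omega
  set P := pinnedChain ω₂ lam β γ with hP
  set i0 : Fin L := ⟨0, by omega⟩ with hi0
  set im : Fin L := ⟨m, by omega⟩ with him
  set im1 : Fin L := ⟨m + 1, by omega⟩ with him1
  have hg1 : ContDiff ℝ 1 g := hg.of_le (by norm_cast)
  have hh1 : ContDiff ℝ 1 h := hh.of_le (by norm_cast)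
  have hgc : Continuous g := hg.continuous
  have hhc : Continuous h := hh.continuous
  have hdgc : ∀ j, Continuous (partialP j g) := fun j => continuous_partialP hg1 one_ne_zero j
  have hdhc : ∀ j, Continuous (partialP j h) := fun j => continuous_partialP hh1 one_ne_zero j
  have hkc : Continuous fun x : PhaseSpace L => kin L 0 x - T := (continuous_kin 0).sub continuous_const
  -- the two pairs in weighted form (`S_{𝟙_0 + 𝟙_s} = thermo 0 + thermo s`)
  have hpg' : ∀ x, 1 * liouvilleOp P L g x +
      γ * bathOp L (fun i : Fin L => (if i.val = 0 then (1 : ℝ) else 0) + (if i.val = m then 1 else 0)) T g x =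
        -(kin L 0 x - T) := fun x => by
    rw [one_mul, ← relocDirichlet_thermo_add_thermo_eq_bathOp]; exact hpg x
  have hph' : ∀ x, -1 * liouvilleOp P L h x +
      γ * bathOp L (fun i : Fin L => (if i.val = 0 then (1 : ℝ) else 0) + (if i.val = m + 1 then 1 else 0)) T h x =
        -(kin L 0 x - T) := fun x => by
    rw [neg_one_mul, ← relocDirichlet_thermo_add_thermo_eq_bathOp]; exact hph x
  -- the source `k_0 = p_0² − T` is in `L²(μ_T)`
  have hk2 : MemLp (fun x => kin L 0 x - T) 2 (P.gibbsMeasure L T) := by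
    haveI := isFiniteMeasure_gibbsMeasure P L T
    exact (pinnedChain_memLp_two_kin hω hl hβ γ L 0 hT).sub (memLp_const T)
  -- finite entropy production at the thermostatted sites (`σ = 1` for `g`, `σ = −1` for `h`)
  have hdg0 : MemLp (partialP i0 g) 2 (P.gibbsMeasure L T) :=
    memLp_partialP hω hl hβ γ L hT _ (relocDirichlet_weight_nonneg L m) 1 hγ hg hg2 hk2 hpg'
      (relocDirichlet_weight_pos_zero hL0 m)
  have hdgm : MemLp (partialP im g) 2 (P.gibbsMeasure L T) :=
    memLp_partialP hω hl hβ γ L hT _ (relocDirichlet_weight_nonneg L m) 1 hγ hg hg2 hk2 hpg'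
      (relocDirichlet_weight_pos_site (by omega))
  have hdh0 : MemLp (partialP i0 h) 2 (P.gibbsMeasure L T) :=
    memLp_partialP hω hl hβ γ L hT _ (relocDirichlet_weight_nonneg L (m + 1)) (-1) hγ hh hh2 hk2 hph'
      (relocDirichlet_weight_pos_zero hL0 (m + 1))
  have hdhm1 : MemLp (partialP im1 h) 2 (P.gibbsMeasure L T) :=
    memLp_partialP hω hl hβ γ L hT _ (relocDirichlet_weight_nonneg L (m + 1)) (-1) hγ hh hh2 hk2 hph'
      (relocDirichlet_weight_pos_site hm1L)
  -- the source terms converge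
  have hIh : Integrable fun x => h x * (kin L 0 x - T) * P.gibbsDensity L T x :=
    integrable_mul_mul_gibbsDensity hω hl hβ γ L hT hh2 hk2
  have hIg : Integrable fun x => g x * (kin L 0 x - T) * P.gibbsDensity L T x :=
    integrable_mul_mul_gibbsDensity hω hl hβ γ L hT hg2 hk2
  have hlimh : Tendsto (fun n : ℕ => ∫ x, chi P L n x * h x * (kin L 0 x - T) * P.gibbsDensity L T x) atTop
      (𝓝 (∫ x, h x * (kin L 0 x - T) * P.gibbsDensity L T x)) := by
    refine (tendsto_integral_chi_mul hω.le hl hβ γ L T (F := fun x => h x * (kin L 0 x - T))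
      (hhc.mul hkc).aestronglyMeasurable hIh).congr fun n => ?_
    exact integral_congr_ae (ae_of_all _ fun x => by ring)
  have hlimg : Tendsto (fun n : ℕ => ∫ x, chi P L n x * g x * (kin L 0 x - T) * P.gibbsDensity L T x) atTop
      (𝓝 (∫ x, g x * (kin L 0 x - T) * P.gibbsDensity L T x)) := by
    refine (tendsto_integral_chi_mul hω.le hl hβ γ L T (F := fun x => g x * (kin L 0 x - T))
      (hgc.mul hkc).aestronglyMeasurable hIg).congr fun n => ?_
    exact integral_congr_ae (ae_of_all _ fun x => by ring)
  -- the three cutoff-gradient terms vanish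
  have hb0 : Tendsto (fun n : ℕ => ∫ x, (h x * partialP i0 g x - g x * partialP i0 h x) *
      partialP i0 (chi P L n) x * P.gibbsDensity L T x) atTop (𝓝 0) := by
    have hF : Integrable fun x => (h x * partialP i0 g x - g x * partialP i0 h x) * P.gibbsDensity L T x :=
      (integrable_mul_gibbsDensity_iff hω hl hβ γ L hT (fun x => h x * partialP i0 g x - g x * partialP i0 h x)).mpr
        ((hh2.integrable_mul hdg0).sub (hg2.integrable_mul hdh0))
    refine (tendsto_integral_partialP_chi_mul hω hl hβ γ L T i0
      (F := fun x => h x * partialP i0 g x - g x * partialP i0 h x)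
      (by fun_prop : Continuous fun x => h x * partialP i0 g x - g x * partialP i0 h x).aestronglyMeasurable
      hF).congr fun n => ?_
    exact integral_congr_ae (ae_of_all _ fun x => by ring)
  have hbm : Tendsto (fun n : ℕ => ∫ x, h x * partialP im g x * partialP im (chi P L n) x *
      P.gibbsDensity L T x) atTop (𝓝 0) := by
    have hF : Integrable fun x => h x * partialP im g x * P.gibbsDensity L T x :=
      integrable_mul_mul_gibbsDensity hω hl hβ γ L hT hh2 hdgm
    refine (tendsto_integral_partialP_chi_mul hω hl hβ γ L T im (F := fun x => h x * partialP im g x)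
      (by fun_prop : Continuous fun x => h x * partialP im g x).aestronglyMeasurable hF).congr fun n => ?_
    exact integral_congr_ae (ae_of_all _ fun x => by ring)
  have hbm1 : Tendsto (fun n : ℕ => ∫ x, g x * partialP im1 h x * partialP im1 (chi P L n) x *
      P.gibbsDensity L T x) atTop (𝓝 0) := by
    have hF : Integrable fun x => g x * partialP im1 h x * P.gibbsDensity L T x :=
      integrable_mul_mul_gibbsDensity hω hl hβ γ L hT hg2 hdhm1
    refine (tendsto_integral_partialP_chi_mul hω hl hβ γ L T im1 (F := fun x => g x * partialP im1 h x)
      (by fun_prop : Continuous fun x => g x * partialP im1 h x).aestronglyMeasurable hF).congr fun n => ?_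
    exact integral_congr_ae (ae_of_all _ fun x => by ring)
  -- assemble: bulk difference = (source terms) − (cutoff-gradient terms), by `reloc_increment_level`
  have hbdry := ((hb0.add hbm).sub hbm1).const_mul (γ * T)
  rw [add_zero, sub_zero, mul_zero] at hbdry
  have hall := (hlimh.sub hlimg).sub hbdry
  rw [sub_zero] at hall
  refine hall.congr fun n => ?_
  have e := reloc_increment_level hω hl hβ hm hmL hT hg hh hpg hph n
  linarith

/-- **The relocation increment identity, cutoff removed (against the Gibbs measure `μ_T`).** Same as
`reloc_increment_identity_density` with all integrals taken against `μ_T = Z⁻¹ ρ dx`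
(`OscillatorChain.integral_gibbsMeasure`):
`γT(∫ χ_n ∂_m g ∂_m h dμ_T − ∫ χ_n ∂_{m+1} g ∂_{m+1} h dμ_T) → ⟨h, k_0⟩_{μ_T} − ⟨g, k_0⟩_{μ_T}`. [folklore] -/
theorem reloc_increment_identity (hω : 0 < ω₂) (hl : 0 ≤ lam) (hβ : 0 ≤ β) (hγ : 0 < γ) {L m : ℕ}
    (hm : 1 ≤ m) (hmL : m + 2 ≤ L) {T : ℝ} (hT : 0 < T) {g h : PhaseSpace L → ℝ} (hg : ContDiff ℝ 2 g)
    (hh : ContDiff ℝ 2 h) (hg2 : MemLp g 2 ((pinnedChain ω₂ lam β γ).gibbsMeasure L T))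
    (hh2 : MemLp h 2 ((pinnedChain ω₂ lam β γ).gibbsMeasure L T))
    (hpg : ∀ x, liouvilleOp (pinnedChain ω₂ lam β γ) L g x + γ * (thermo L 0 T g x + thermo L m T g x) =
      -(kin L 0 x - T))
    (hph : ∀ x, -liouvilleOp (pinnedChain ω₂ lam β γ) L h x + γ * (thermo L 0 T h x + thermo L (m + 1) T h x) =
      -(kin L 0 x - T)) :
    Tendsto (fun n : ℕ => γ * T *
        ((∫ x, chi (pinnedChain ω₂ lam β γ) L n x * partialP ⟨m, by omega⟩ g x * partialP ⟨m, by omega⟩ h x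
            ∂((pinnedChain ω₂ lam β γ).gibbsMeasure L T)) -
          ∫ x, chi (pinnedChain ω₂ lam β γ) L n x * partialP ⟨m + 1, by omega⟩ g x *
            partialP ⟨m + 1, by omega⟩ h x ∂((pinnedChain ω₂ lam β γ).gibbsMeasure L T))) atTop
      (𝓝 ((∫ x, h x * (kin L 0 x - T) ∂((pinnedChain ω₂ lam β γ).gibbsMeasure L T)) -
        ∫ x, g x * (kin L 0 x - T) ∂((pinnedChain ω₂ lam β γ).gibbsMeasure L T))) := by
  have hρ := reloc_increment_identity_density hω hl hβ hγ hm hmL hT hg hh hg2 hh2 hpg hph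
  simp only [OscillatorChain.integral_gibbsMeasure]
  rw [← mul_sub]
  refine (hρ.const_mul ((∫ x, (pinnedChain ω₂ lam β γ).gibbsDensity L T x)⁻¹)).congr fun n => ?_
  ring

end Limit

/-- Registered helper `helper_relocIncrementIdentity` toward stub `stub_bulkStep` (= `reloc_increment_identity` in stub
form, all integrals against `μ_T`; line `cold-bath-relocation-walk`, crux stmt-AtomisticToContinuum-11749). [folklore] -/
theorem helper_relocIncrementIdentity : ∀ {ω₂ lam β γ : ℝ}, 0 < ω₂ → 0 ≤ lam → 0 ≤ β → 0 < γ → ∀ {L m : ℕ} (hm : 1 ≤ m) (hmL : m + 2 ≤ L) {T : ℝ}, 0 < T → ∀ {g h : PhaseSpace L → ℝ}, ContDiff ℝ 2 g → ContDiff ℝ 2 h → MemLp g 2 ((pinnedChain ω₂ lam β γ).gibbsMeasure L T) → MemLp h 2 ((pinnedChain ω₂ lam β γ).gibbsMeasure L T) → (∀ x, liouvilleOp (pinnedChain ω₂ lam β γ) L g x + γ * (thermo L 0 T g x + thermo L m T g x) = -(kin L 0 x - T)) → (∀ x, -liouvilleOp (pinnedChain ω₂ lam β γ) L h x + γ * (thermo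 L 0 T h x + thermo L (m + 1) T h x) = -(kin L 0 x - T)) → Tendsto (fun n : ℕ => γ * T * ((∫ x, chi (pinnedChain ω₂ lam β γ) L n x * partialP ⟨m, by omega⟩ g x * partialP ⟨m, by omega⟩ h x ∂((pinnedChain ω₂ lam β γ).gibbsMeasure L T)) - ∫ x, chi (pinnedChain ω₂ lam β γ) L n x * partialP ⟨m + 1, by omega⟩ g x * partialP ⟨m + 1, by omega⟩ h x ∂((pinnedChain ω₂ lam β γ).gibbsMeasure L T))) atTop (𝓝 ((∫ x, h x * (kin L 0 x - T) ∂((pinnedChain ω₂ lam β γ).gibbsMeasure L T)) - ∫ x, g x * (kin L 0 x - T) ∂((pinnedChain ω₂ lam β γ).gibbsMeasure L T))) :=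
  @reloc_increment_identity

end Summit.AtomisticToContinuum.FouriersLaw.Cruxes.ConductanceLowerBound.ColdBathRelocationWalk

end
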